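import Summits.Ventures.Crystal3D.Theorems.StickyWulffConstantNoReconstructionGainExactLevelBound
import HarnessLib

/-!
# EXACT₀ ⟹ the crux's inequality up to the deep-band wrapped off-lattice balls (line `replication-exactness`)

HONEST FRAMING. Part of the venture `Summits/Ventures/Crystal3D` (cell `crystal3d-full`), supports the
crux `NoReconstructionGain` (stmt-Ventures-19144, route `route-Ventures-StickyWulffConstant`), line
`replication-exactness` (lead wulff-p1 g17).  The deep-band variant of `…ExactLevelBound`:

* `deficit_ge_of_exactZeroGain_sub_offLattice_deep` — for `R ≥ 8`: `D(X) ≥ 2φ(ν)πρ² − Cρ −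
  12(⌊#S/K⌋ + 1)` for EVERY unit packing `X ⊇ P_ρ(ν,R)`, `S` = its off-lattice balls of height in
  `(−2R+2, −R−2)`, `K = ⌊(R−6)/2⌋`.  Such balls lie outside the disc (over the disc the sample leaves no
  room at those heights), i.e. they are WRAPPED: with this form the line's residual becomes the
  confinement of cores (`#S ≤ L·K·ρ`), used by the skeleton v4.

WHAT THIS IS NOT: the confinement of cores and EXACT₀ are open; rung F-C1 not moved.
-/

noncomputable section

namespace Summit.Ventures.Crystal3D.Theorems

open Summit.Ventures.Crystal3D
open Literature.MathematicalPhysics.StatisticalMechanics (fccStacking contactDeficiency orderedContacts)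
open scoped InnerProductSpace
open Finset

open scoped Classical in
/-- **DEEP-BAND form of `deficit_ge_of_exactZeroGain_sub_offLattice`.**  For `R ≥ 8` there is `C` such
that every unit packing `X ⊇ P_ρ(ν,R)` (`ρ ≥ R`) satisfies `D(X) ≥ 2φ(ν)πρ² − Cρ − 12·(⌊#S / K⌋ + 1)` with
`S` its off-lattice balls of height in the DEEP band `(−2R+2, −R−2)` and `K = ⌊(R−6)/2⌋` (levels
`−2R+3+2k`).  A ball of such height cannot lie over the disc (it would come within `1/√2` of a site of the
sample), so `S` consists of WRAPPED balls only (lateral distance `> ρ − 1`): the residual of the line is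
the CONFINEMENT statement `#S ≤ L·K·ρ` for cores. -/
theorem deficit_ge_of_exactZeroGain_sub_offLattice_deep (hE : ExactZeroGain) (R : ℝ) (hR : 8 ≤ R) :
    ∃ C : ℝ, ∀ ν : EuclideanSpace ℝ (Fin 3), ‖ν‖ = 1 → ∀ ρ : ℝ, R ≤ ρ →
      ∀ X P : Finset (EuclideanSpace ℝ (Fin 3)),
      (∀ p ∈ X, ∀ q ∈ X, p ≠ q → 1 ≤ dist p q) → P ⊆ X →
      (∀ p, p ∈ P ↔ (p ∈ fccStacking 1 (Real.sqrt (2 / 3)) ∧ -(2 * R) ≤ ⟪p, ν⟫_ℝ ∧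
        ⟪p, ν⟫_ℝ ≤ -R ∧ ‖p‖ ^ 2 - ⟪p, ν⟫_ℝ ^ 2 ≤ ρ ^ 2)) →
      2 * (Real.sqrt 2 / 4 * ∑ᶠ w ∈ {w ∈ fccStacking 1 (Real.sqrt (2 / 3)) | ‖w‖ = 1},
          |⟪w, ν⟫_ℝ|) * Real.pi * ρ ^ 2 - C * ρ -
          12 * ((((X.filter fun x => x ∉ fccStacking 1 (Real.sqrt (2 / 3)) ∧ -(2 * R) + 2 < ⟪x, ν⟫_ℝ ∧
            ⟪x, ν⟫_ℝ < -R - 2).card / ⌊(R - 6) / 2⌋₊ : ℕ) : ℝ) + 1) ≤ contactDeficiency X := by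
  classical
  obtain ⟨C, hC⟩ := deficit_ge_of_exactZeroGain_of_level hE R (by linarith)
  refine ⟨C, ?_⟩
  intro ν hν ρ hρ X P hX hPX hP
  set K : ℕ := ⌊(R - 6) / 2⌋₊ with hK
  set S := X.filter fun x => x ∉ fccStacking 1 (Real.sqrt (2 / 3)) ∧ -(2 * R) + 2 < ⟪x, ν⟫_ℝ ∧
    ⟪x, ν⟫_ℝ < -R - 2 with hS
  set f : EuclideanSpace ℝ (Fin 3) → ℕ := fun x => ⌊(⟪x, ν⟫_ℝ + 2 * R - 2) / 2⌋₊ with hf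
  have hK1 : 1 ≤ K := by
    rw [hK]; exact Nat.one_le_floor_iff _ |>.2 (by linarith)
  have hKpos : 0 < K := hK1
  -- a least-loaded level
  obtain ⟨k, hkK, hk⟩ := Finset.exists_card_fiber_le_of_card_le_mul (f := f) (s := S)
    (t := Finset.range K) ⟨0, Finset.mem_range.2 hKpos⟩ (n := S.card / K + 1)
    (by rw [Finset.card_range]; have := Nat.lt_div_mul_add (a := S.card) hKpos; nlinarith [this])
  rw [Finset.mem_range] at hkK
  set B := S.filter fun x => f x = k with hB
  have hBS : B ⊆ S := Finset.filter_subset _ _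
  have hSX : S ⊆ X := Finset.filter_subset _ _
  have hBX : B ⊆ X := hBS.trans hSX
  -- delete `B`
  set X' := X \ B with hX'
  have hX'X : X' ⊆ X := Finset.sdiff_subset
  have hX'pack : ∀ p ∈ X', ∀ q ∈ X', p ≠ q → 1 ≤ dist p q :=
    fun p hp q hq hne => hX p (hX'X hp) q (hX'X hq) hne
  have hPX' : P ⊆ X' := by
    intro p hp
    rw [hX', Finset.mem_sdiff]
    refine ⟨hPX hp, fun hpB => ?_⟩
    have := (Finset.mem_filter.1 (hBS hpB)).2.1
    exact this ((hP p).1 hp).1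
  have hKR : (K : ℝ) ≤ (R - 6) / 2 := Nat.floor_le (by linarith)
  have hkR : (k : ℝ) ≤ (R - 6) / 2 - 1 := by
    have : (k : ℝ) + 1 ≤ K := by exact_mod_cast hkK
    linarith
  have hk0 : (0 : ℝ) ≤ k := Nat.cast_nonneg k
  -- the level `−2R + 3 + 2k` is off-lattice-free for `X'`
  have hlevel : ∀ x ∈ X', x ∉ fccStacking 1 (Real.sqrt (2 / 3)) →
      1 ≤ |⟪x, ν⟫_ℝ - (-(2 * R) + 3 + 2 * k)| := by
    intro x hx hxΛ
    by_contra hlt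
    push Not at hlt
    rw [abs_lt] at hlt
    obtain ⟨h1, h2⟩ := hlt
    have hxS : x ∈ S := by
      rw [hS, Finset.mem_filter]
      exact ⟨hX'X hx, hxΛ, by linarith, by linarith⟩
    have hfx : f x = k := by
      rw [hf]
      refine (Nat.floor_eq_iff (by linarith)).2 ⟨?_, ?_⟩
      · have : (k : ℝ) * 2 ≤ ⟪x, ν⟫_ℝ + 2 * R - 2 := by linarith
        linarith
      · have : ⟪x, ν⟫_ℝ + 2 * R - 2 < ((k : ℝ) + 1) * 2 := by linarith
        linarith
    have hxB : x ∈ B := by rw [hB, Finset.mem_filter]; exact ⟨hxS, hfx⟩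
    exact (Finset.mem_sdiff.1 hx).2 hxB
  have hDX' := hC ν hν ρ hρ X' P hX'pack hPX' hP (-(2 * R) + 3 + 2 * k) (by linarith) (by linarith) hlevel
  -- put `B` back
  have hsplit := contactDeficiency_sdiff_split (X := X) (P := X') hX'X
  have hXB : X \ X' = B := by
    rw [hX', Finset.sdiff_sdiff_eq_self hBX]
  rw [hXB] at hsplit
  have hcross := card_cross_le_twelve_mul X B hX
  have hDB := contactDeficiency_nonneg_of_packing B fun p hp q hq hne => hX p (hBX hp) q (hBX hq) hne
  have hcross' : ((((X \ B) ×ˢ B).filter fun pq => dist pq.1 pq.2 = 1).card : ℝ) ≤ 12 * (B.card : ℝ) := by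
    exact_mod_cast hcross
  have hBcard : (B.card : ℝ) ≤ ((S.card / K : ℕ) : ℝ) + 1 := by
    have : B.card ≤ S.card / K + 1 := hk
    exact_mod_cast this
  rw [← hX'] at hcross'
  linarith

end Summit.Ventures.Crystal3D.Theorems

end
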